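import Summits.KontsevichZagierPeriods.Zeta5Search.LaiSweepShard

/-!
# `κ₃` sweep certificate — shard file 078 of 127 (shards 546–552 of 889)

HONEST FRAMING. Systematic search; no irrationality claim unless certified. This file only checks,
by `decide +kernel`, shards 546–552 of the order-cell sweep of the `κ₃` point `(74, 2180, 444; δ74)`
(engine `LaiSweepEngine`, soundness `LaiSweepJump/Free/Eval/Shard/Kappa3`; a shard is `⟨regime, n,
p, q, p', q', Lo, Up⟩`: `n` cells from `p/q` to `p'/q'` with integer rate sums in `[Lo, Up]`, `K =
128`, `D = 2^40`). It draws NO conclusion: only the capstone `LaiKappa3SweepCert`, which needs all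
127 shard files, does. Kernel cost of this file ≈ 560 cells × 0.3 s.
-/

namespace Summit.KontsevichZagierPeriods.Zeta5Search.Sweep

set_option maxHeartbeats 100000000 in
/-- Shard 546: 80 cells of regime B from `95/167` to `240/421`.
[cite: Lai2024BallRivoal, §4 Lemma 4.3] -/
theorem shard546 :
    Shard.check 128 (2^40)
      ⟨true, 80, 95, 167, 240, 421, 13214395263111, 16980310837811⟩ = true := by
  decide +kernel

set_option maxHeartbeats 100000000 in
/-- Shard 547: 80 cells of regime B from `240/421` to `249/436`.
[cite: Lai2024BallRivoal, §4 Lemma 4.3] -/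
theorem shard547 :
    Shard.check 128 (2^40)
      ⟨true, 80, 240, 421, 249, 436, 11233463782005, 14447603017545⟩ = true := by
  decide +kernel

set_option maxHeartbeats 100000000 in
/-- Shard 548: 80 cells of regime B from `249/436` to `197/344`.
[cite: Lai2024BallRivoal, §4 Lemma 4.3] -/
theorem shard548 :
    Shard.check 128 (2^40)
      ⟨true, 80, 249, 436, 197, 344, 17139059421791, 22067120283945⟩ = true := by
  decide +kernel

set_option maxHeartbeats 100000000 in
/-- Shard 549: 80 cells of regime B from `197/344` to `66/115`.
[cite: Lai2024BallRivoal, §4 Lemma 4.3] -/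
theorem shard549 :
    Shard.check 128 (2^40)
      ⟨true, 80, 197, 344, 66, 115, 13475562268457, 17368645984935⟩ = true := by
  decide +kernel

set_option maxHeartbeats 100000000 in
/-- Shard 550: 80 cells of regime B from `66/115` to `88/153`.
[cite: Lai2024BallRivoal, §4 Lemma 4.3] -/
theorem shard550 :
    Shard.check 128 (2^40)
      ⟨true, 80, 66, 115, 88, 153, 13590725130055, 17534492975497⟩ = true := by
  decide +kernel

set_option maxHeartbeats 100000000 in
/-- Shard 551: 80 cells of regime B from `88/153` to `132/229`.
[cite: Lai2024BallRivoal, §4 Lemma 4.3] -/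
theorem shard551 :
    Shard.check 128 (2^40)
      ⟨true, 80, 88, 153, 132, 229, 13627433324506, 17599404395695⟩ = true := by
  decide +kernel

set_option maxHeartbeats 100000000 in
/-- Shard 552: 80 cells of regime B from `132/229` to `119/206`.
[cite: Lai2024BallRivoal, §4 Lemma 4.3] -/
theorem shard552 :
    Shard.check 128 (2^40)
      ⟨true, 80, 132, 229, 119, 206, 13551966349310, 17519514511524⟩ = true := by
  decide +kernel

/-- The checked shards of this file, in order. [folklore] -/
def shards078 : List (CheckedShard 128 (2^40)) :=
  [⟨_, shard546⟩, ⟨_, shard547⟩, ⟨_, shard548⟩, ⟨_, shard549⟩, ⟨_, shard550⟩,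
    ⟨_, shard551⟩, ⟨_, shard552⟩]

end Summit.KontsevichZagierPeriods.Zeta5Search.Sweep
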